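import Literature.NumberTheory.GaloisRepresentations.WeakAbelianDirectSummand
import Literature.NumberTheory.GaloisRepresentations.FrobeniusDensity
import Literature.NumberTheory.GaloisRepresentations.ArtinCharacterReciprocity
import Literature.NumberTheory.Automorphic.ChebotarevArtinRepHolds
import Literature.NumberTheory.GaloisRepresentations.FrobeniusDensityOneProofs
import Literature.NumberTheory.GaloisRepresentations.LAdicCharacterUnramifiedAEProofs
import HarnessLib

/-!
# Weak abelian direct summands (Böckle–Hui 2025): Prop. 2.4 in the cofinite case, proved

Topic `NumberTheory/GaloisRepresentations`; namespace
`Literature.NumberTheory.GaloisRepresentations`.  A *proofs* file (theorems only; no definition,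
no named fact), sibling of `WeakAbelianDirectSummand.lean` (the named fact
`exists_heckeCharacter_of_weaklyDivides`, Böckle–Hui Thm. 1.1).

Böckle–Hui, *Weak abelian direct summands and irreducibility of Galois representations*,
Math. Ann. 393 (2025), **Proposition 2.4**: "If `ψ` weakly divides `ρ`, then
`S_{ψ∣ρ} = Σ_K ∖ (S_ρ ∪ S_ψ)`", i.e. the divisibility of Frobenius characteristic polynomials on a
density-one set propagates to EVERY unramified place.  Its printed proof: the minors of the
Sylvester matrix of `(charpoly ρ(σ), charpoly ψ(σ))` are continuous functions of `σ ∈ Γ_K` which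
vanish on the Frobenii of a density-one set of places, "hence by the Chebotarev density theorem"
they vanish identically, so `charpoly ψ(σ) ∣ charpoly ρ(σ)` for ALL `σ ∈ Γ_K`.

This file proves the statement for a character `ψ` (rank `m = 1`, where the Sylvester matrix
reduces to the single number `charpoly ρ(σ) (ψ(σ))`) and for divisibility given off a FINITE set
of places — the generality in which the tree has Chebotarev's theorem: the arithmetic Frobenii at
the places outside any finite set are dense in `Γ_K` (`absoluteGaloisGroup.frobenius_dense`, from
the PROVED existence form `Automorphic.chebotarev_artinRep_holds`).  The density-one version
needs Chebotarev's theorem with Dirichlet densities over a general number field, which the tree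
states only as the predicate `LFunctions.Chebotarev.HasChebotarevDensities` (proved for `K = ℚ`);
the density-one version is obtained at the end of the file by a different route (Frobenius'
theorem and power-stability, `FrobeniusDensityOneProofs.lean`).

* `FramedGaloisRep.continuous_eval_charpoly` — `σ ↦ charpoly ρ(σ) (a(σ))` is continuous for a
  continuous scalar function `a` (`= det (a(σ) - ρ(σ))`, Mathlib `Matrix.eval_charpoly`).
* `FramedGaloisRep.charpoly_dvd_charpoly_of_eventually` — **BH Prop. 2.4, cofinite case, `m = 1`**:
  if `charpoly ψ(Φ) ∣ charpoly ρ(Φ)` for the arithmetic Frobenii `Φ` above all but finitely many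
  `v`, then `charpoly ψ(σ) ∣ charpoly ρ(σ)` for every `σ ∈ Γ_K`.
* `FramedGaloisRep.exists_eigenvector_of_eventually` — equivalently `ψ(σ)` is an eigenvalue of
  `ρ(σ)` for every `σ`: `∃ x ≠ 0, ρ(σ) x = ψ(σ) x`.
* `FramedGaloisRep.charpoly_dvd_charpoly_of_cofinite` — the same from a weak divisibility
  witnessed by a COFINITE set `𝓛`.
* **`FramedGaloisRep.charpoly_dvd_charpoly_of_weaklyDivides`** (appended) — **BH Prop. 2.4 for a
  character `ψ` in the printed generality** (`𝓛` of Dirichlet density one): `ψ.WeaklyDivides ρ`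
  implies `charpoly ψ(σ) ∣ charpoly ρ(σ)` for every `σ ∈ Γ_K`; `exists_eigenvector_of_weaklyDivides`
  — eigenvalue form.  Chebotarev's density theorem (not in the tree over a general `K`) is
  replaced by Frobenius' division theorem along a density-one set
  (`FrobeniusDensityOneProofs.lean`) and the stability of the zero set of
  `σ ↦ charpoly ρ(σ)(ψ(σ))` under powers.

* `FramedGaloisRep.WeaklyDivides.eventually_isRoot_map` (appended) — with `ρ` `E`-rational
  (`IsRationalOver e`): at all but finitely many `v`, every `ψ(Frob_v)` is a root of the monic
  Frobenius polynomial `P_v^e ∈ e(E[X])` of `ρ` at `v`;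
  `FramedGaloisRep.WeaklyDivides.eventually_isAlgebraic` — over `ℚ̄_ℓ` with `E` a number field:
  `ψ` is unramified and `ψ(Frob_v) ∈ ℚ̄` at all but finitely many `v` — the hypotheses of
  BH Thm. 2.2 (Waldschmidt) for `τ_ℓ = ψ_ℓ`, as invoked in the printed proof of Thm. 1.1 (§2.7:
  "Since `ψ_ℓ` weakly divides `ρ_ℓ`, there exists `N ∈ ℕ` such that `ψ_ℓ^N` is locally algebraic by
  `E`-rationality of `ρ_ℓ` and Theorem 2.2").

* `FramedGaloisRep.WeaklyDivides.eventually_charpoly_dvd`, `weaklyDivides_iff_eventually`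
  (appended) — **Prop. 2.4 as printed, "`S_{ψ∣ρ} = Σ_K ∖ (S_ρ ∪ S_ψ)`"**: for `ρ`, `ψ` unramified
  almost everywhere, `ψ` weakly divides `ρ` iff the divisibility holds at all but finitely many
  places (over `ℚ̄_ℓ` the unramifiedness of the character `ψ` is automatic,
  `weaklyDivides_iff_eventually_padic`); `WeaklyDivides.eq_of_rank_one` — between characters,
  weak divisibility is equality (BH Cor. 2.10 (iii) in rank one).

## References

* G. Böckle, C.-Y. Hui, Math. Ann. 393 (2025), Prop. 2.4 and its proof; Thm. 2.2 and §2.7.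
  [BockleHui2025]
* J.-P. Serre, *Abelian ℓ-adic representations and elliptic curves* (1968), Ch. I §2.2, Cor. 2 (a)
  (Frobenius elements are dense). [SerreAbelianLadic1968]
-/

noncomputable section

open scoped NumberField Matrix Topology
open NumberField Field IsDedekindDomain Polynomial Filter

namespace Literature.NumberTheory.GaloisRepresentations

namespace FramedGaloisRep

variable {K : Type} [Field K] [NumberField K] {A : Type*} [CommRing A] [TopologicalSpace A]
  [IsTopologicalRing A] {n : ℕ}

omit [NumberField K] in
/-- **Continuity of `σ ↦ charpoly ρ(σ) (a(σ))`** for a framed representation `ρ` and a continuous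
scalar function `a` on `Γ_K`: by `Matrix.eval_charpoly` this is `det (a(σ) · 1 - ρ(σ))`, a
polynomial in the (continuous) matrix entries. [folklore] -/
theorem continuous_eval_charpoly (ρ : FramedGaloisRep K A n) {a : absoluteGaloisGroup K → A}
    (ha : Continuous a) : Continuous fun σ => (FramedRep.charpoly ρ σ).eval (a σ) := by
  have hM : Continuous fun σ : absoluteGaloisGroup K =>
      ((ρ σ : GL (Fin n) A) : Matrix (Fin n) (Fin n) A) :=
    Units.continuous_val.comp ρ.continuous
  have h : Continuous fun σ : absoluteGaloisGroup K =>
      (Matrix.scalar (Fin n) (a σ) - ((ρ σ : GL (Fin n) A) : Matrix (Fin n) (Fin n) A)).det := by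
    refine Continuous.matrix_det (Continuous.sub ?_ hM)
    refine continuous_matrix fun i j => ?_
    by_cases hij : i = j
    · subst hij
      simpa [Matrix.scalar_apply] using ha
    · simp [Matrix.scalar_apply, hij, continuous_const]
  refine h.congr fun σ => ?_
  rw [FramedRep.charpoly, Matrix.eval_charpoly]

omit [NumberField K] [IsTopologicalRing A] in
/-- The entry of a rank-one framed representation is continuous. [folklore] -/
theorem continuous_apply_zero_zero (ψ : FramedGaloisRep K A 1) :
    Continuous fun σ : absoluteGaloisGroup K =>
      ((ψ σ : GL (Fin 1) A) : Matrix (Fin 1) (Fin 1) A) 0 0 :=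
  (Units.continuous_val.comp ψ.continuous).matrix_elem 0 0

omit [NumberField K] [IsTopologicalRing A] in
/-- For a character `ψ`, `charpoly ψ(σ) ∣ charpoly ρ(σ)` iff the entry `ψ(σ)₀₀` is a root of
`charpoly ρ(σ)` (`charpoly ψ(σ) = X - ψ(σ)₀₀`, `Polynomial.dvd_iff_isRoot`). [folklore] -/
theorem charpoly_dvd_charpoly_iff_eval_eq_zero (ψ : FramedGaloisRep K A 1)
    (ρ : FramedGaloisRep K A n) (σ : absoluteGaloisGroup K) :
    FramedRep.charpoly ψ σ ∣ FramedRep.charpoly ρ σ ↔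
      (FramedRep.charpoly ρ σ).eval (((ψ σ : GL (Fin 1) A) : Matrix (Fin 1) (Fin 1) A) 0 0) =
        0 := by
  rw [charpoly_eq_of_rank_one, dvd_iff_isRoot, IsRoot.def]

/-- **Böckle–Hui, Prop. 2.4 (cofinite case, `ψ` a character).**  Let `ρ : Γ_K →ₜ* GL_n(A)` and
`ψ : Γ_K →ₜ* GL_1(A)` be continuous (`A` a Hausdorff topological ring, e.g. `ℚ̄_ℓ`) and suppose that
for all but finitely many finite places `v` of the number field `K`,
`charpoly ψ(Φ) ∣ charpoly ρ(Φ)` for every arithmetic Frobenius `Φ` above `v`.  Then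
`charpoly ψ(σ) ∣ charpoly ρ(σ)` for EVERY `σ ∈ Γ_K`: the continuous function
`σ ↦ charpoly ρ(σ) (ψ(σ))` (`continuous_eval_charpoly`) vanishes on the Frobenii outside a finite
set, which are dense in `Γ_K` by Chebotarev (`absoluteGaloisGroup.frobenius_dense` with the proved
`Automorphic.chebotarev_artinRep_holds`), hence vanishes identically.  BH: "by our hypothesis …
the map vanishes on the elements `Frob_v`, for `v` in a density one subset of places of `K`. Hence
by the Chebotarev density theorem the map … is identically zero. It follows that `s_{λ,σ}` divides
`r_{λ,σ}` for all `σ ∈ Gal_K`." [cite: BockleHui2025, Proposition 2.4 (proof)] -/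
theorem charpoly_dvd_charpoly_of_eventually [T2Space A] (ψ : FramedGaloisRep K A 1)
    (ρ : FramedGaloisRep K A n)
    (h : ∀ᶠ v : HeightOneSpectrum (𝓞 K) in cofinite, ∀ 𝔓 ∈ v.primesAbove,
      ∀ Φ : absoluteGaloisGroup K, IsArithFrobAt (𝓞 K) Φ 𝔓 →
        FramedRep.charpoly ψ Φ ∣ FramedRep.charpoly ρ Φ)
    (σ : absoluteGaloisGroup K) : FramedRep.charpoly ψ σ ∣ FramedRep.charpoly ρ σ := by
  set f : absoluteGaloisGroup K → A := fun σ =>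
    (FramedRep.charpoly ρ σ).eval (((ψ σ : GL (Fin 1) A) : Matrix (Fin 1) (Fin 1) A) 0 0) with hf
  have hfc : Continuous f := ρ.continuous_eval_charpoly ψ.continuous_apply_zero_zero
  -- the finite exceptional set and the dense set of good Frobenii
  set S : Set (HeightOneSpectrum (𝓞 K)) := {v | ¬ ∀ 𝔓 ∈ v.primesAbove,
    ∀ Φ : absoluteGaloisGroup K, IsArithFrobAt (𝓞 K) Φ 𝔓 →
      FramedRep.charpoly ψ Φ ∣ FramedRep.charpoly ρ Φ} with hS
  have hSfin : S.Finite := Filter.eventually_cofinite.mp h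
  have hdense := absoluteGaloisGroup.frobenius_dense Automorphic.chebotarev_artinRep_holds K S hSfin
  -- `f` vanishes on the dense set, hence everywhere
  have hzero :
      {τ : absoluteGaloisGroup K | ∃ v ∉ S, ∃ 𝔓 ∈ v.primesAbove, IsArithFrobAt (𝓞 K) τ 𝔓} ⊆
        {τ | f τ = 0} := by
    rintro τ ⟨v, hvS, 𝔓, h𝔓, hτ⟩
    have hv : ∀ 𝔓 ∈ v.primesAbove, ∀ Φ : absoluteGaloisGroup K, IsArithFrobAt (𝓞 K) Φ 𝔓 →
        FramedRep.charpoly ψ Φ ∣ FramedRep.charpoly ρ Φ := by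
      by_contra hc
      exact hvS hc
    exact (ψ.charpoly_dvd_charpoly_iff_eval_eq_zero ρ τ).mp (hv 𝔓 h𝔓 τ hτ)
  have hclosed : IsClosed {τ : absoluteGaloisGroup K | f τ = 0} := isClosed_eq hfc continuous_const
  have hall : {τ : absoluteGaloisGroup K | f τ = 0} = Set.univ := by
    refine Set.eq_univ_of_univ_subset ?_
    rw [← (hdense.mono hzero).closure_eq]
    exact hclosed.closure_subset_iff.mpr le_rfl
  have hσ : f σ = 0 := by
    have : σ ∈ {τ : absoluteGaloisGroup K | f τ = 0} := by rw [hall]; exact Set.mem_univ σ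
    exact this
  exact (ψ.charpoly_dvd_charpoly_iff_eval_eq_zero ρ σ).mpr hσ

/-- **Eigenvalue form.**  Under the hypotheses of `charpoly_dvd_charpoly_of_eventually`, with `A`
a field: for every `σ ∈ Γ_K`, `ψ(σ)` is an eigenvalue of `ρ(σ)`, i.e. there is `x ≠ 0` with
`ρ(σ) x = ψ(σ)₀₀ • x` (a root of the characteristic polynomial is an eigenvalue,
Mathlib `Matrix.exists_mulVec_eq_zero_iff`).  This is the shape in which BH use Prop. 2.4 for a
weak ABELIAN direct summand of rank one. [cite: BockleHui2025, Proposition 2.4] -/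
theorem exists_eigenvector_of_eventually {F : Type*} [Field F] [TopologicalSpace F]
    [IsTopologicalRing F] [T2Space F] (ψ : FramedGaloisRep K F 1) (ρ : FramedGaloisRep K F n)
    (h : ∀ᶠ v : HeightOneSpectrum (𝓞 K) in cofinite, ∀ 𝔓 ∈ v.primesAbove,
      ∀ Φ : absoluteGaloisGroup K, IsArithFrobAt (𝓞 K) Φ 𝔓 →
        FramedRep.charpoly ψ Φ ∣ FramedRep.charpoly ρ Φ)
    (σ : absoluteGaloisGroup K) :
    ∃ x : Fin n → F, x ≠ 0 ∧
      ((ρ σ : GL (Fin n) F) : Matrix (Fin n) (Fin n) F) *ᵥ x =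
        (((ψ σ : GL (Fin 1) F) : Matrix (Fin 1) (Fin 1) F) 0 0) • x := by
  have hd := ψ.charpoly_dvd_charpoly_of_eventually ρ h σ
  rw [charpoly_dvd_charpoly_iff_eval_eq_zero, FramedRep.charpoly, Matrix.eval_charpoly,
    ← Matrix.exists_mulVec_eq_zero_iff] at hd
  obtain ⟨x, hx0, hx⟩ := hd
  refine ⟨x, hx0, ?_⟩
  rw [Matrix.sub_mulVec, sub_eq_zero] at hx
  rw [← hx]
  ext i
  simp [Matrix.scalar_apply, Matrix.mulVec, dotProduct, Finset.sum_ite_eq, Matrix.diagonal]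

/-- **From a cofinite weak divisibility.**  If `ψ.WeaklyDivides ρ` is witnessed by a COFINITE set
`𝓛` (as in `WeaklyDivides.of_eventually`, e.g. for genuine direct summands), then
`charpoly ψ(σ) ∣ charpoly ρ(σ)` for every `σ ∈ Γ_K` (BH Prop. 2.4 in this case).
[cite: BockleHui2025, Proposition 2.4] -/
theorem charpoly_dvd_charpoly_of_cofinite [T2Space A] (ψ : FramedGaloisRep K A 1)
    (ρ : FramedGaloisRep K A n) {𝓛 : Set (HeightOneSpectrum (𝓞 K))} (h𝓛 : 𝓛ᶜ.Finite)
    (h : ∀ v ∈ 𝓛, ρ.IsUnramifiedAt v ∧ ψ.IsUnramifiedAt v ∧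
      ∀ 𝔓 ∈ v.primesAbove, ∀ σ : absoluteGaloisGroup K, IsArithFrobAt (𝓞 K) σ 𝔓 →
        FramedRep.charpoly ψ σ ∣ FramedRep.charpoly ρ σ)
    (σ : absoluteGaloisGroup K) : FramedRep.charpoly ψ σ ∣ FramedRep.charpoly ρ σ := by
  refine ψ.charpoly_dvd_charpoly_of_eventually ρ ?_ σ
  rw [Filter.eventually_cofinite]
  refine h𝓛.subset fun v hv => ?_
  intro hv𝓛
  exact hv (h v hv𝓛).2.2


/-! ### Böckle–Hui Prop. 2.4 for characters: the density-one version -/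

section DensityOne

variable {K : Type} [Field K] [NumberField K] {A : Type*} [CommRing A] [TopologicalSpace A]
  [IsTopologicalRing A] [T2Space A] {n : ℕ}

/-- **Böckle–Hui, Prop. 2.4 (`ψ` a character, `𝓛` of Dirichlet density one — the printed
generality).**  If the character `ψ : Γ_K →ₜ* GL_1(A)` weakly divides `ρ : Γ_K →ₜ* GL_n(A)`
(`FramedGaloisRep.WeaklyDivides`: `charpoly ψ(Frob_v) ∣ charpoly ρ(Frob_v)` for all `v` in a set
`𝓛` of Dirichlet density one, Böckle–Hui Def. 2.3), then `charpoly ψ(σ) ∣ charpoly ρ(σ)` for EVERY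
`σ ∈ Γ_K` ("`S_{ψ∣ρ} = Σ_K ∖ (S_ρ ∪ S_ψ)`" and more: also at the ramified places and off
Frobenius elements).  The printed proof applies Chebotarev's density theorem to the continuous
function `σ ↦ charpoly ρ(σ)(ψ(σ))`; here Chebotarev is replaced by the tree's proved Frobenius
division theorem through the density criterion
`absoluteGaloisGroup.eq_univ_of_frobenius_mem_of_hasDirichletDensity_one`: the zero set
`Z = {σ : charpoly ρ(σ)(ψ(σ)₀₀) = 0}` is closed (`continuous_eval_charpoly`), contains the Frobenii
over `𝓛`, and is stable under powers (`ψ(σ)₀₀ · 1 - ρ(σ)` divides `ψ(σ)₀₀ᵏ · 1 - ρ(σ)ᵏ`), hence is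
all of `Γ_K`. [cite: BockleHui2025, Proposition 2.4] -/
theorem charpoly_dvd_charpoly_of_weaklyDivides (ψ : FramedGaloisRep K A 1)
    (ρ : FramedGaloisRep K A n) (h : ψ.WeaklyDivides ρ) (σ : absoluteGaloisGroup K) :
    FramedRep.charpoly ψ σ ∣ FramedRep.charpoly ρ σ := by
  obtain ⟨𝓛, h𝓛, hdiv⟩ := h
  set f : absoluteGaloisGroup K → A := fun τ =>
    (FramedRep.charpoly ρ τ).eval (((ψ τ : GL (Fin 1) A) : Matrix (Fin 1) (Fin 1) A) 0 0) with hf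
  have hfc : Continuous f := ρ.continuous_eval_charpoly ψ.continuous_apply_zero_zero
  set Z : Set (absoluteGaloisGroup K) := {τ | f τ = 0} with hZ
  have hZc : IsClosed Z := isClosed_eq hfc continuous_const
  -- `Z` is stable under positive powers
  have hpow : ∀ τ ∈ Z, ∀ k : ℕ, 0 < k → τ ^ k ∈ Z := by
    intro τ hτ k _
    change (FramedRep.charpoly ρ (τ ^ k)).eval
      (((ψ (τ ^ k) : GL (Fin 1) A) : Matrix (Fin 1) (Fin 1) A) 0 0) = 0
    have hτ' : (FramedRep.charpoly ρ τ).eval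
        (((ψ τ : GL (Fin 1) A) : Matrix (Fin 1) (Fin 1) A) 0 0) = 0 := hτ
    set a : A := ((ψ τ : GL (Fin 1) A) : Matrix (Fin 1) (Fin 1) A) 0 0 with hadef
    set M : Matrix (Fin n) (Fin n) A := ((ρ τ : GL (Fin n) A) : Matrix (Fin n) (Fin n) A) with hMdef
    have ha : ((ψ (τ ^ k) : GL (Fin 1) A) : Matrix (Fin 1) (Fin 1) A) 0 0 = a ^ k := by
      rw [map_pow, Units.val_pow_eq_pow_val]
      have hdet := Matrix.det_fin_one (((ψ τ : GL (Fin 1) A) : Matrix (Fin 1) (Fin 1) A) ^ k)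
      rw [← hdet, Matrix.det_pow, Matrix.det_fin_one]
    have hM : ((ρ (τ ^ k) : GL (Fin n) A) : Matrix (Fin n) (Fin n) A) = M ^ k := by
      rw [map_pow, Units.val_pow_eq_pow_val]
    rw [FramedRep.charpoly, Matrix.eval_charpoly] at hτ' ⊢
    rw [ha, hM, map_pow]
    obtain ⟨S, hS⟩ := (Matrix.scalar_commute a (fun r => Commute.all a r) M).sub_dvd_pow_sub_pow k
    rw [hS, Matrix.det_mul, hτ', zero_mul]
  -- `Z` contains the Frobenii over `𝓛`
  have hfrob : ∀ v ∈ 𝓛, ∀ 𝔓 ∈ v.primesAbove, ∀ Φ : absoluteGaloisGroup K,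
      IsArithFrobAt (𝓞 K) Φ 𝔓 → Φ ∈ Z := fun v hv 𝔓 h𝔓 Φ hΦ =>
    (ψ.charpoly_dvd_charpoly_iff_eval_eq_zero ρ Φ).mp ((hdiv v hv).2.2 𝔓 h𝔓 Φ hΦ)
  -- hence `Z = Γ_K`
  have hZu := absoluteGaloisGroup.eq_univ_of_frobenius_mem_of_hasDirichletDensity_one hZc hpow h𝓛
    hfrob
  have hσ : σ ∈ Z := by rw [hZu]; exact Set.mem_univ σ
  exact (ψ.charpoly_dvd_charpoly_iff_eval_eq_zero ρ σ).mpr hσ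

/-- **Eigenvalue form of Prop. 2.4 (density one).**  Over a field: if the character `ψ` weakly
divides `ρ`, then for every `σ ∈ Γ_K`, `ψ(σ)` is an eigenvalue of `ρ(σ)`.
[cite: BockleHui2025, Proposition 2.4] -/
theorem exists_eigenvector_of_weaklyDivides {F : Type*} [Field F] [TopologicalSpace F]
    [IsTopologicalRing F] [T2Space F] (ψ : FramedGaloisRep K F 1) (ρ : FramedGaloisRep K F n)
    (h : ψ.WeaklyDivides ρ) (σ : absoluteGaloisGroup K) :
    ∃ x : Fin n → F, x ≠ 0 ∧
      ((ρ σ : GL (Fin n) F) : Matrix (Fin n) (Fin n) F) *ᵥ x =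
        (((ψ σ : GL (Fin 1) F) : Matrix (Fin 1) (Fin 1) F) 0 0) • x := by
  have hd := charpoly_dvd_charpoly_of_weaklyDivides ψ ρ h σ
  rw [charpoly_dvd_charpoly_iff_eval_eq_zero, FramedRep.charpoly, Matrix.eval_charpoly,
    ← Matrix.exists_mulVec_eq_zero_iff] at hd
  obtain ⟨x, hx0, hx⟩ := hd
  refine ⟨x, hx0, ?_⟩
  rw [Matrix.sub_mulVec, sub_eq_zero] at hx
  rw [← hx]
  ext i
  simp [Matrix.scalar_apply, Matrix.mulVec, dotProduct, Finset.sum_ite_eq, Matrix.diagonal]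

/-- **Frobenius values of a weak abelian direct summand of an `E`-rational representation are
roots of the `E`-rational Frobenius polynomials, at every good place.**  If the character `ψ`
weakly divides `ρ` (BH Def. 2.3) and `ρ` is `E`-rational with respect to `e : E → A`
(`IsRationalOver e`), then at all but finitely many finite places `v` of `K`, `ρ` is unramified at
`v` with Frobenius characteristic polynomial `P_v^e`, `P_v ∈ E[X]`, and for EVERY arithmetic
Frobenius `σ` at every prime above `v`, `ψ(σ)` is a root of `P_v^e` (Prop. 2.4 in the strong form
`charpoly_dvd_charpoly_of_weaklyDivides`: `charpoly ψ(σ) ∣ charpoly ρ(σ)` for all `σ`; no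
unramifiedness of `ψ` is needed).  This is the `E`-rationality input to Thm. 2.2 in the printed
proof of Thm. 1.1. [cite: BockleHui2025, Proposition 2.4 and §2.7 (proof of Theorem 1.1)] -/
theorem WeaklyDivides.eventually_isRoot_map (ψ : FramedGaloisRep K A 1) (ρ : FramedGaloisRep K A n)
    {E : Type*} [CommRing E] {e : E →+* A} (hρ : ρ.IsRationalOver e) (h : ψ.WeaklyDivides ρ) :
    ∀ᶠ v : HeightOneSpectrum (𝓞 K) in cofinite, ρ.IsUnramifiedAt v ∧
      ∃ P : E[X], ρ.HasFrobCharpolyAt v (P.map e) ∧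
        ∀ 𝔓 ∈ v.primesAbove, ∀ σ : absoluteGaloisGroup K, IsArithFrobAt (𝓞 K) σ 𝔓 →
          (P.map e).Monic ∧ (P.map e).IsRoot (((ψ σ : GL (Fin 1) A) : Matrix (Fin 1) (Fin 1) A) 0 0) := by
  refine hρ.mono fun v hv => ⟨hv.1, ?_⟩
  obtain ⟨P, hP⟩ := hv.2
  refine ⟨P, hP, fun 𝔓 h𝔓 σ hσ => ?_⟩
  have hch : FramedRep.charpoly ρ σ = P.map e := hP 𝔓 h𝔓 σ hσ
  refine ⟨hch ▸ Matrix.charpoly_monic _, ?_⟩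
  have hd := (charpoly_dvd_charpoly_iff_eval_eq_zero ψ ρ σ).mp
    (charpoly_dvd_charpoly_of_weaklyDivides ψ ρ h σ)
  rwa [hch] at hd

/-- **The hypotheses of Böckle–Hui's Thm. 2.2 (Waldschmidt) hold for a weak abelian direct
summand of an `E`-rational `ℓ`-adic representation** (printed proof of Thm. 1.1, §2.7: "Since
`ψ_ℓ` weakly divides `ρ_ℓ`, there exists `N ∈ ℕ` such that `ψ_ℓ^N` is locally algebraic by
`E`-rationality of `ρ_ℓ` and Theorem 2.2"; Thm. 2.2: "Suppose `τ_ℓ : Gal_K → ℚ̄_ℓˣ` is an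
one-dimensional `ℓ`-adic representation unramified outside a finite set `S ⊂ Σ_K` such that
`τ_ℓ(Frob_v) ∈ ℚ̄` for all `v ∈ Σ_K ∖ S`. Then …").  For a number field `E` with `e : E → ℚ̄_ℓ`, an
`E`-rational `ρ : Γ_K →ₜ* GL_n(ℚ̄_ℓ)` and a character `ψ : Γ_K →ₜ* GL_1(ℚ̄_ℓ)` weakly dividing `ρ`:
at all but finitely many `v`, `ψ` is unramified at `v` (`eventually_isUnramifiedAt_of_rank_one`)
and `ψ(Frob_v)` is algebraic over `ℚ` for every arithmetic Frobenius at every prime above `v` (a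
root of the monic `P_v^e`, `P_v ∈ E[X]`, `E/ℚ` algebraic: `WeaklyDivides.eventually_isRoot_map`).
[cite: BockleHui2025, Theorem 2.2 (hypotheses) and §2.7 (proof of Theorem 1.1)] -/
theorem WeaklyDivides.eventually_isAlgebraic {ℓ : ℕ} [Fact ℓ.Prime] {E : Type*} [Field E]
    [NumberField E] (e : E →+* PadicAlgCl ℓ) {ρ : FramedGaloisRep K (PadicAlgCl ℓ) n}
    (hρ : ρ.IsRationalOver e) {ψ : FramedGaloisRep K (PadicAlgCl ℓ) 1} (h : ψ.WeaklyDivides ρ) :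
    ∀ᶠ v : HeightOneSpectrum (𝓞 K) in cofinite, ρ.IsUnramifiedAt v ∧ ψ.IsUnramifiedAt v ∧
      ∀ 𝔓 ∈ v.primesAbove, ∀ σ : absoluteGaloisGroup K, IsArithFrobAt (𝓞 K) σ 𝔓 →
        IsAlgebraic ℚ ((((ψ σ : GL (Fin 1) (PadicAlgCl ℓ)) :
          Matrix (Fin 1) (Fin 1) (PadicAlgCl ℓ)) 0 0)) := by
  letI : Algebra E (PadicAlgCl ℓ) := e.toAlgebra
  haveI : IsScalarTower ℚ E (PadicAlgCl ℓ) :=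
    IsScalarTower.of_algebraMap_eq' (Subsingleton.elim _ _)
  filter_upwards [WeaklyDivides.eventually_isRoot_map ψ ρ hρ h,
    ψ.eventually_isUnramifiedAt_of_rank_one] with v hv hψv
  obtain ⟨hunr, P, -, hroot⟩ := hv
  refine ⟨hunr, hψv, fun 𝔓 h𝔓 σ hσ => ?_⟩
  obtain ⟨hmon, hr⟩ := hroot 𝔓 h𝔓 σ hσ
  have hint : IsIntegral E ((((ψ σ : GL (Fin 1) (PadicAlgCl ℓ)) :
      Matrix (Fin 1) (Fin 1) (PadicAlgCl ℓ)) 0 0)) := by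
    refine ⟨P, monic_of_injective e.injective hmon, ?_⟩
    rw [← Polynomial.eval_map]
    exact hr
  exact (isIntegral_trans (R := ℚ) _ hint).isAlgebraic

/-- **Böckle–Hui, Prop. 2.4 as printed ("If `ψ` weakly divides `ρ`, then
`S_{ψ∣ρ} = Σ_K ∖ (S_ρ ∪ S_ψ)`"), for a character `ψ`.**  If `ρ` and `ψ` are unramified at all
but finitely many places and `ψ` weakly divides `ρ`, then at all but finitely many places `v` both
are unramified and `charpoly ψ(σ) ∣ charpoly ρ(σ)` for every arithmetic Frobenius `σ` above `v`
(indeed for every `σ ∈ Γ_K`, `charpoly_dvd_charpoly_of_weaklyDivides`).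
[cite: BockleHui2025, Proposition 2.4] -/
theorem WeaklyDivides.eventually_charpoly_dvd {ψ : FramedGaloisRep K A 1} {ρ : FramedGaloisRep K A n}
    (h : ψ.WeaklyDivides ρ) (hρ : ∀ᶠ v : HeightOneSpectrum (𝓞 K) in cofinite, ρ.IsUnramifiedAt v)
    (hψ : ∀ᶠ v : HeightOneSpectrum (𝓞 K) in cofinite, ψ.IsUnramifiedAt v) :
    ∀ᶠ v : HeightOneSpectrum (𝓞 K) in cofinite, ρ.IsUnramifiedAt v ∧ ψ.IsUnramifiedAt v ∧
      ∀ 𝔓 ∈ v.primesAbove, ∀ σ : absoluteGaloisGroup K, IsArithFrobAt (𝓞 K) σ 𝔓 →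
        FramedRep.charpoly ψ σ ∣ FramedRep.charpoly ρ σ := by
  filter_upwards [hρ, hψ] with v hρv hψv
  exact ⟨hρv, hψv, fun _ _ σ _ => charpoly_dvd_charpoly_of_weaklyDivides ψ ρ h σ⟩

/-- **`S_{ψ∣ρ} = Σ_K ∖ (S_ρ ∪ S_ψ)` as an equivalence**: for `ρ`, `ψ` unramified almost
everywhere, the character `ψ` weakly divides `ρ` (divisibility on a set of Dirichlet density one,
BH Def. 2.3) iff the divisibility holds at all but finitely many places
(`WeaklyDivides.eventually_charpoly_dvd`, `WeaklyDivides.of_eventually`).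
[cite: BockleHui2025, Proposition 2.4 with Definition 2.3] -/
theorem weaklyDivides_iff_eventually {ψ : FramedGaloisRep K A 1} {ρ : FramedGaloisRep K A n}
    (hρ : ∀ᶠ v : HeightOneSpectrum (𝓞 K) in cofinite, ρ.IsUnramifiedAt v)
    (hψ : ∀ᶠ v : HeightOneSpectrum (𝓞 K) in cofinite, ψ.IsUnramifiedAt v) :
    ψ.WeaklyDivides ρ ↔
      ∀ᶠ v : HeightOneSpectrum (𝓞 K) in cofinite, ρ.IsUnramifiedAt v ∧ ψ.IsUnramifiedAt v ∧
        ∀ 𝔓 ∈ v.primesAbove, ∀ σ : absoluteGaloisGroup K, IsArithFrobAt (𝓞 K) σ 𝔓 →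
          FramedRep.charpoly ψ σ ∣ FramedRep.charpoly ρ σ :=
  ⟨fun h => h.eventually_charpoly_dvd hρ hψ, WeaklyDivides.of_eventually⟩

/-- **`ℓ`-adic form**: for `ρ : Γ_K →ₜ* GL_n(ℚ̄_ℓ)` unramified almost everywhere and ANY continuous
character `ψ : Γ_K →ₜ* GL_1(ℚ̄_ℓ)` (automatically unramified almost everywhere,
`eventually_isUnramifiedAt_of_rank_one`), `ψ` weakly divides `ρ` iff `charpoly ψ(Frob_v)` divides
`charpoly ρ(Frob_v)` at all but finitely many `v`. [cite: BockleHui2025, Proposition 2.4] -/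
theorem weaklyDivides_iff_eventually_padic {ℓ : ℕ} [Fact ℓ.Prime]
    {ψ : FramedGaloisRep K (PadicAlgCl ℓ) 1} {ρ : FramedGaloisRep K (PadicAlgCl ℓ) n}
    (hρ : ∀ᶠ v : HeightOneSpectrum (𝓞 K) in cofinite, ρ.IsUnramifiedAt v) :
    ψ.WeaklyDivides ρ ↔
      ∀ᶠ v : HeightOneSpectrum (𝓞 K) in cofinite, ρ.IsUnramifiedAt v ∧ ψ.IsUnramifiedAt v ∧
        ∀ 𝔓 ∈ v.primesAbove, ∀ σ : absoluteGaloisGroup K, IsArithFrobAt (𝓞 K) σ 𝔓 →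
          FramedRep.charpoly ψ σ ∣ FramedRep.charpoly ρ σ :=
  weaklyDivides_iff_eventually hρ ψ.eventually_isUnramifiedAt_of_rank_one

/-- **Between characters, weak divisibility is equality** (Böckle–Hui Cor. 2.10 (iii) — "if `ρ`
and `ψ` are abelian, then `ψ` weakly divides `ρ` if and only if `ψ` is a direct summand of `ρ`" —
in rank one, where a direct summand of a character is the character itself; here for continuous
characters `ψ, ν : Γ_K →ₜ* GL_1(A)` over any Hausdorff topological ring, without monodromy
hypotheses): by Prop. 2.4 in the strong form `charpoly_dvd_charpoly_of_weaklyDivides`,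
`X - ψ(σ) ∣ X - ν(σ)`, i.e. `ψ(σ) = ν(σ)`, for every `σ ∈ Γ_K`.
[cite: BockleHui2025, Corollary 2.10 (iii) with Proposition 2.4] -/
theorem WeaklyDivides.eq_of_rank_one {ψ ν : FramedGaloisRep K A 1} (h : ψ.WeaklyDivides ν) :
    ψ = ν := by
  refine ContinuousMonoidHom.ext fun σ => ?_
  have hd := charpoly_dvd_charpoly_of_weaklyDivides ψ ν h σ
  rw [charpoly_eq_of_rank_one, charpoly_eq_of_rank_one, dvd_iff_isRoot, IsRoot.def, eval_sub,
    eval_X, eval_C, sub_eq_zero] at hd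
  refine Units.ext (Matrix.ext fun i j => ?_)
  rw [Subsingleton.elim i 0, Subsingleton.elim j 0]
  exact hd

end DensityOne

end FramedGaloisRep

end Literature.NumberTheory.GaloisRepresentations
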